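import Literature.Computability.AlgebraicComplexity.DIP20MonomialCounts
import Literature.Computability.AlgebraicComplexity.DIP20PlethysmCountingFormulaProofs
import HarnessLib

/-!
# Dörfler–Ikenmeyer–Panova 2020, eq. (4.3): a kernel-checkable dynamic programme for the
# four-letter monomial counts `c_ν(d,n)`

Topic `Literature/Computability/AlgebraicComplexity`; sibling proofs/evaluator file (D-0014) of
`DIP20MonomialCounts.lean` (t07: `countVecMultisets`, `weakComps`, `dipMonomialCount_eq_eval`). No new facts;
the definitions introduced are evaluator plumbing (`digitAt`, `flat3`, `dpStep`, `dpRun`, `dpTables`, `cvm4`).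

J. Dörfler, C. Ikenmeyer, G. Panova, SIAM J. Appl. Algebra Geom. 4 (2020) = arXiv:1901.04576, eq. (4.3)
(arXiv p. 9): `c_ν(d,n) = #{b : |b| = d, Σ_i b_i α^i = ν}`, the number of multisets of `d` weak compositions
`α^i` of `n` with vector sum `ν`; with (4.4) these evaluate the plethysm coefficients `a_λ(d[n])` of the
table of Prop. 3.15. The four-letter entry `λ = (14,14,13,13) ⊢ 54` of that table is out of reach of the
enumerating evaluator of `DIP20MonomialCounts.lean` (≈ 6·10⁸ multisets per count); this file supplies the
polynomial-time route.

## Method (what is proved)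

For a list `L` of weak `4`-compositions of `n` and `e ≤ d`, the whole layer
`(w₀,w₁,w₂) ↦ countVecMultisets L e (w₀,w₁,w₂,ne−w₀−w₁−w₂)` (`cvm4`; the fourth coordinate is implicit) is
stored as ONE natural number in base `2^F` (digit `digitAt F N p` at the flat position
`p = flat3 W w₀ w₁ w₂ = (w₀W + w₁)W + w₂`, inner width `W = nd+1`, outer axis cut at `D₀`). Prepending a
composition `α` to `L` is the geometric step
`countVecMultisets (α::L) (e+1) w = countVecMultisets L (e+1) w + countVecMultisets (α::L) e (w−α)`
(`countVecMultisets_cons_succ`), i.e. on packed layers `new_{e+1} = old_{e+1} + (new_e · 2^{F·s(α)}) mod 2^{F·D₀W²}`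
(`dpStep`) — three GMP-accelerated kernel operations per (composition, layer). Correctness
(`digitAt_dpTables`, `dipMonomialCount_eq_digitAt_dpTables`) rests on: base-`2^F` digit lemmas (carry-free
addition `digitAt_add`, shift `digitAt_mul_pow`, truncation `digitAt_mod_pow`), the no-wrap property of the
flat index (reachable coordinates are `≤ ne ≤ nd < W`, via the total-degree lemma
`sum_eq_of_countVecMultisets_ne_zero`), and the size bound `countVecMultisets L e w ≤ (|L|+1)^e < 2^F`
(`countVecMultisets_le_pow`). The packaged form for plethysm coefficients of `4`-row partitions is
`plethysmCoeff_fin_four_cast_eq_dp` ((4.4) = `DIP20_eq_4_4_holds` with every `c_ν` read off the last layer).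

**Part II (masked layout, for the tails of Lemma 3.13).** When the first coordinate is huge and the other
three are tiny (`λ = (dn − |τ|, τ)`), the dense layout is hopeless (inner widths `nd+1`). `dpTablesM`
stores per layer only the box `w₁ < D₁, w₂ < D₂, w₃ < D₃` of the three SMALL coordinates (the first one is
implicit, `cvmT`), with padding `P ≥ n` on the two inner axes (`boxIdx (D₂+P) (D₃+P)`) so that one shift
never wraps into the box, and clears the padding after every shift by one `Nat.land` with `boxMask`
(all-ones digits on the box, built by `packDigits`; digits of `&&&`: `digitAt_land` through `Nat.testBit`).
Correctness `digitAt_dpTablesM` / `dipMonomialCount_eq_digitAt_dpTablesM`; the right-hand side of (4.4)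
for ANY `4`-row vector of size `dn` through one masked table: `dip44_rhs_eq_dpM` (a pure counting
identity — this is the form in which the clamped tail sums `dip44_sum_cons_clamp` of
`DIP20MonomialCountStabilisation.lean` are kernel-evaluated), and `plethysmCoeff_fin_four_cast_eq_dpM`.

HONEST FRAMING: elementary counting/evaluation plumbing for the toy model's §4; nothing here bears on
permanent versus determinant; VP ≠ VNP is not proved.

## References

* J. Dörfler, C. Ikenmeyer, G. Panova, SIAM J. Appl. Algebra Geom. 4 (2020) = arXiv:1901.04576,
  eqs. (4.3)–(4.4), Prop. 3.15. [DorflerIkenmeyerPanova2020]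
* D. E. Knuth, *The Art of Computer Programming* 2, §4.3.3 / §4.6.4 (Kronecker substitution: polynomial
  arithmetic packed into long integers). [folklore]

## Mathlib and tree

Mathlib: `Nat.add_mod`, `Nat.add_div_eq_of_add_mod_lt`, `Nat.mod_mul_right_div_self`, `Nat.mod_mod_of_dvd`,
`Nat.div_div_eq_div_mul`, `Nat.div_add_mod`, `Nat.mul_div_mul_left`, `Nat.testBit_land`, `Nat.testBit_mod_two_pow`,
`Nat.testBit_div_two_pow`, `Nat.eq_of_testBit_eq`, `Nat.and_two_pow_sub_one_eq_mod`, `Nat.and_zero`,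
`Finset.sum_congr`, `Equiv.sum_comp`, `Fin.sum_univ_four`.
Tree: `countVecMultisets`, `weakComps`, `mem_weakComps_iff`, `sumUpTo`, `dipMonomialCountEval`,
`dipMonomialCount_eq_eval` (`DIP20MonomialCounts`, t07); `DIP20_eq_4_4_holds` (`DIP20PlethysmCountingFormulaProofs`,
p6); `plethysmCoeff`, `rowDual`, `dipMonomialCount`, `DIP20_eq_4_4` (`DIP20MultiplicityObstructions`,
`SchurWeylPlethysm`).

Kernel cost (measured on the farm, `lean check`): the two row-5 evaluations of Prop. 3.15's table
(`(n,d) = (6,9)`: 84 compositions, 10 layers; `(9,6)`: 220 compositions, 7 layers; base `2^58` / `2^48`,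
layer literals ≈ 3·10⁶ bits) take ≈ 14 s each by `decide +kernel`, including the sum over `S_4`; with the
masked layout (box `17 × 15 × 14`, literals ≈ 4·10⁵ bits) a few seconds, and the largest tail base value
of Lemma 3.13 (`τ = (5,5,5)` at `(d,n) = (15,15)`: 816 compositions, 16 layers, base `2^146`, literals
≈ 5·10⁵ bits) ≈ 20 s.

Provenance: val-lit cell, prover val-lit-p4 g3 (Prop. 3.15 table row 5; registry claims on
`DIP20_prop_3_15_table`, `DIP20_prop_3_15`).
-/

namespace Literature.Computability.AlgebraicComplexity

/-! ### Base-`2^F` digits -/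

section Digits

/-- The digit of `N` at position `i` in base `2^F`. [folklore] -/
def digitAt (F N i : ℕ) : ℕ := N / 2 ^ (F * i) % 2 ^ F

/-- The digit at position `0`. [folklore] -/
private theorem digitAt_zero_right (F N : ℕ) : digitAt F N 0 = N % 2 ^ F := by
  simp [digitAt]

/-- Shifting the position by one divides by the base. [folklore] -/
private theorem digitAt_succ (F N i : ℕ) : digitAt F N (i + 1) = digitAt F (N / 2 ^ F) i := by
  unfold digitAt
  rw [Nat.mul_succ, pow_add, mul_comm (2 ^ (F * i)), ← Nat.div_div_eq_div_mul]

/-- The digits of `0`. [folklore] -/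
private theorem digitAt_zero (F i : ℕ) : digitAt F 0 i = 0 := by
  simp [digitAt]

/-- The digits of `1` (for a base `> 1`). [folklore] -/
private theorem digitAt_one {F : ℕ} (hF : 0 < F) (i : ℕ) : digitAt F 1 i = if i = 0 then 1 else 0 := by
  unfold digitAt
  have h2 : 1 < 2 ^ F := Nat.one_lt_two_pow (Nat.pos_iff_ne_zero.mp hF)
  split_ifs with hi
  · subst hi
    simp [Nat.mod_eq_of_lt h2]
  · have : 1 < 2 ^ (F * i) := Nat.one_lt_two_pow (Nat.mul_ne_zero (Nat.pos_iff_ne_zero.mp hF) hi)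
    rw [Nat.div_eq_of_lt this, Nat.zero_mod]

/-- **Carry-free addition**: if no digit sum reaches the base, the digits of the sum are the sums of
the digits. [folklore] -/
private theorem digitAt_add {F : ℕ} :
    ∀ (A C : ℕ), (∀ j, digitAt F A j + digitAt F C j < 2 ^ F) →
      ∀ i, digitAt F (A + C) i = digitAt F A i + digitAt F C i := by
  intro A C h i
  induction i generalizing A C with
  | zero =>
    have h0 := h 0
    rw [digitAt_zero_right, digitAt_zero_right] at h0
    rw [digitAt_zero_right, digitAt_zero_right, digitAt_zero_right, Nat.add_mod, Nat.mod_eq_of_lt h0]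
  | succ i ih =>
    have h0 := h 0
    rw [digitAt_zero_right, digitAt_zero_right] at h0
    rw [digitAt_succ, digitAt_succ, digitAt_succ, Nat.add_div_eq_of_add_mod_lt h0]
    exact ih _ _ fun j => by rw [← digitAt_succ, ← digitAt_succ]; exact h (j + 1)

/-- **Shift**: multiplying by `2^{Fs}` moves the digits up by `s` positions. [folklore] -/
private theorem digitAt_mul_pow (F B s i : ℕ) :
    digitAt F (B * 2 ^ (F * s)) i = if s ≤ i then digitAt F B (i - s) else 0 := by
  unfold digitAt
  have hpos : ∀ t : ℕ, 0 < 2 ^ t := fun t => Nat.two_pow_pos _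
  split_ifs with h
  · obtain ⟨k, rfl⟩ := Nat.exists_eq_add_of_le h
    rw [Nat.add_sub_cancel_left, Nat.mul_add, pow_add, mul_comm B,
      Nat.mul_div_mul_left _ _ (hpos _)]
  · obtain ⟨k, rfl⟩ := Nat.exists_eq_add_of_lt (not_le.mp h)
    have hs : F * (i + k + 1) = F * i + F * (k + 1) := by ring
    rw [hs, pow_add, mul_comm (2 ^ (F * i)), ← mul_assoc, Nat.mul_div_cancel _ (hpos _)]
    apply Nat.mod_eq_zero_of_dvd
    exact Dvd.dvd.mul_left (pow_dvd_pow 2 (Nat.le_mul_of_pos_right F (Nat.succ_pos k))) B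

/-- **Truncation**: reducing modulo `2^{FK}` keeps the digits below position `K` and kills the rest.
[folklore] -/
private theorem digitAt_mod_pow (F X K i : ℕ) :
    digitAt F (X % 2 ^ (F * K)) i = if i < K then digitAt F X i else 0 := by
  unfold digitAt
  have hpos : ∀ t : ℕ, 0 < 2 ^ t := fun t => Nat.two_pow_pos _
  split_ifs with h
  · obtain ⟨k, rfl⟩ := Nat.exists_eq_add_of_lt h
    have hs : F * (i + k + 1) = F * i + F * (k + 1) := by ring
    rw [hs, pow_add, Nat.mod_mul_right_div_self,
      Nat.mod_mod_of_dvd _ (pow_dvd_pow 2 (Nat.le_mul_of_pos_right F (Nat.succ_pos k)))]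
  · have hle : 2 ^ (F * K) ≤ 2 ^ (F * i) := Nat.pow_le_pow_right (by norm_num)
      (Nat.mul_le_mul_left F (not_lt.mp h))
    rw [Nat.div_eq_of_lt (lt_of_lt_of_le (Nat.mod_lt _ (hpos _)) hle), Nat.zero_mod]

end Digits

/-! ### The flat index of a three-dimensional table -/

section FlatIndex

/-- The flat (mixed-radix) position of the cell `(w₀,w₁,w₂)`, inner width `W`. [folklore] -/
def flat3 (W w0 w1 w2 : ℕ) : ℕ := (w0 * W + w1) * W + w2

/-- The flat index is additive. [folklore] -/
private theorem flat3_add (W a0 a1 a2 b0 b1 b2 : ℕ) :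
    flat3 W (a0 + b0) (a1 + b1) (a2 + b2) = flat3 W a0 a1 a2 + flat3 W b0 b1 b2 := by
  unfold flat3; ring

/-- Every position decodes. [folklore] -/
private theorem flat3_decode (W p : ℕ) :
    flat3 W (p / W / W) (p / W % W) (p % W) = p := by
  unfold flat3
  have h1 := Nat.div_add_mod (p / W) W
  have h2 := Nat.div_add_mod p W
  rw [mul_comm (p / W / W), h1, mul_comm, h2]

/-- The inner coordinates are recovered from the flat index. [folklore] -/
private theorem flat3_div_mod {W w0 w1 w2 : ℕ} (h1 : w1 < W) (h2 : w2 < W) :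
    flat3 W w0 w1 w2 / W / W = w0 ∧ flat3 W w0 w1 w2 / W % W = w1 ∧ flat3 W w0 w1 w2 % W = w2 := by
  have hW : 0 < W := by omega
  have hq : flat3 W w0 w1 w2 / W = w0 * W + w1 := by
    unfold flat3
    rw [Nat.add_comm, Nat.add_mul_div_right _ _ hW, Nat.div_eq_of_lt h2, Nat.zero_add]
  refine ⟨?_, ?_, ?_⟩
  · rw [hq, Nat.add_comm, Nat.add_mul_div_right _ _ hW, Nat.div_eq_of_lt h1, Nat.zero_add]
  · rw [hq, Nat.add_comm, Nat.add_mul_mod_self_right, Nat.mod_eq_of_lt h1]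
  · unfold flat3
    rw [Nat.add_comm, Nat.add_mul_mod_self_right, Nat.mod_eq_of_lt h2]

/-- The flat index is injective on cells with in-range inner coordinates. [folklore] -/
private theorem flat3_inj {W a0 a1 a2 b0 b1 b2 : ℕ} (ha1 : a1 < W) (ha2 : a2 < W) (hb1 : b1 < W) (hb2 : b2 < W)
    (h : flat3 W a0 a1 a2 = flat3 W b0 b1 b2) : a0 = b0 ∧ a1 = b1 ∧ a2 = b2 := by
  obtain ⟨e0, e1, e2⟩ := flat3_div_mod (w0 := a0) ha1 ha2
  obtain ⟨f0, f1, f2⟩ := flat3_div_mod (w0 := b0) hb1 hb2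
  exact ⟨by rw [← e0, h, f0], by rw [← e1, h, f1], by rw [← e2, h, f2]⟩

/-- A cell beyond the outer cut `D₀` has flat index `≥ D₀W²`, and conversely for cells with
in-range inner coordinates. [folklore] -/
private theorem flat3_lt_iff {W D0 w0 w1 w2 : ℕ} (h1 : w1 < W) (h2 : w2 < W) :
    flat3 W w0 w1 w2 < D0 * W * W ↔ w0 < D0 := by
  unfold flat3
  constructor
  · intro h
    by_contra hc
    have : D0 * W * W ≤ (w0 * W + w1) * W + w2 := by
      have : D0 * W ≤ w0 * W + w1 := le_trans (Nat.mul_le_mul_right W (not_lt.mp hc)) (Nat.le_add_right _ _)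
      exact le_trans (Nat.mul_le_mul_right W this) (Nat.le_add_right _ _)
    omega
  · intro h
    have h01 : w0 * W + w1 < (w0 + 1) * W := by rw [Nat.succ_mul]; omega
    have : (w0 * W + w1) * W + w2 < (w0 * W + w1 + 1) * W := by rw [Nat.succ_mul]; omega
    calc (w0 * W + w1) * W + w2 < (w0 * W + w1 + 1) * W := this
      _ ≤ (w0 + 1) * W * W := Nat.mul_le_mul_right W h01
      _ ≤ D0 * W * W := Nat.mul_le_mul_right W (Nat.mul_le_mul_right W h)

end FlatIndex

/-! ### Three lemmas on `countVecMultisets`: the geometric step, the total degree, the size bound -/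

section CountLemmas

variable {ℓ : ℕ}

/-- Peeling the first summand of `sumUpTo`. [folklore] -/
private theorem sumUpTo_succ_left (f : ℕ → ℕ) (d : ℕ) :
    sumUpTo f (d + 1) = f 0 + sumUpTo (fun k => f (k + 1)) d := by
  induction d with
  | zero => simp [sumUpTo]
  | succ d ih => rw [sumUpTo, ih, sumUpTo, Nat.add_assoc]

/-- A `sumUpTo` of zeros vanishes. [folklore] -/
private theorem sumUpTo_eq_zero {f : ℕ → ℕ} {d : ℕ} (h : ∀ k ≤ d, f k = 0) : sumUpTo f d = 0 := by
  induction d with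
  | zero => simpa [sumUpTo] using h 0 le_rfl
  | succ d ih => rw [sumUpTo, ih fun k hk => h k (Nat.le_succ_of_le hk), h (d + 1) le_rfl]

/-- A nonzero `sumUpTo` has a nonzero summand. [folklore] -/
private theorem exists_ne_zero_of_sumUpTo_ne_zero {f : ℕ → ℕ} {d : ℕ} (h : sumUpTo f d ≠ 0) :
    ∃ k ≤ d, f k ≠ 0 := by
  by_contra hc
  apply h
  apply sumUpTo_eq_zero
  intro k hk
  by_contra hne
  exact hc ⟨k, hk, hne⟩

/-- `countVecMultisets (α :: L) 0 w = countVecMultisets L 0 w` (no copy of `α` fits in degree `0`).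
[cite: DorflerIkenmeyerPanova2020, eq. (4.3) (arXiv p. 9)] -/
theorem countVecMultisets_cons_zero (α : Fin ℓ → ℕ) (L : List (Fin ℓ → ℕ)) (w : Fin ℓ → ℕ) :
    countVecMultisets (α :: L) 0 w = countVecMultisets L 0 w := by
  rw [countVecMultisets, sumUpTo, if_pos fun i => by simp]
  simp

/-- **The geometric step**: `countVecMultisets (α :: L) (e+1) w =
countVecMultisets L (e+1) w + [α ≤ w] · countVecMultisets (α :: L) e (w − α)` — a multiset over `α :: L`
either avoids `α` or is `{α} +` a smaller one. [cite: DorflerIkenmeyerPanova2020, eq. (4.3) (arXiv p. 9)] -/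
theorem countVecMultisets_cons_succ (α : Fin ℓ → ℕ) (L : List (Fin ℓ → ℕ)) (e : ℕ) (w : Fin ℓ → ℕ) :
    countVecMultisets (α :: L) (e + 1) w = countVecMultisets L (e + 1) w +
      (if ∀ i, α i ≤ w i then countVecMultisets (α :: L) e (fun i => w i - α i) else 0) := by
  rw [countVecMultisets, sumUpTo_succ_left, if_pos fun i => by simp]
  simp only [Nat.zero_mul, Nat.sub_zero]
  congr 1
  rw [countVecMultisets]
  split_ifs with h
  · congr 1
    funext k
    have hiff : (∀ i, (k + 1) * α i ≤ w i) ↔ ∀ i, k * α i ≤ w i - α i := by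
      constructor
      · intro hk i; have := hk i; rw [Nat.add_mul, Nat.one_mul] at this; have := h i; omega
      · intro hk i; have := hk i; have := h i; rw [Nat.add_mul, Nat.one_mul]; omega
    by_cases hk : ∀ i, (k + 1) * α i ≤ w i
    · rw [if_pos hk, if_pos (hiff.mp hk), Nat.add_sub_add_right]
      congr 1
      funext i
      rw [Nat.add_mul, Nat.one_mul, Nat.sub_sub, Nat.add_comm]
    · rw [if_neg hk, if_neg (mt hiff.mpr hk)]
  · apply sumUpTo_eq_zero
    intro k _
    rw [if_neg]
    intro hk
    exact h fun i => le_trans (by rw [Nat.add_mul, Nat.one_mul]; exact Nat.le_add_left _ _) (hk i)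

/-- **Total degree**: a nonzero count forces `Σ w = n·e` when every composition in `L` has sum `n`.
[cite: DorflerIkenmeyerPanova2020, eq. (4.3) (arXiv p. 9)] -/
theorem sum_eq_of_countVecMultisets_ne_zero {n : ℕ} :
    ∀ (L : List (Fin ℓ → ℕ)), (∀ α ∈ L, ∑ i, α i = n) → ∀ (e : ℕ) (w : Fin ℓ → ℕ),
      countVecMultisets L e w ≠ 0 → ∑ i, w i = n * e
  | [], _, e, w, h => by
    rw [countVecMultisets] at h
    by_cases hc : e = 0 ∧ w = 0
    · rw [hc.1, hc.2]; simp
    · exact absurd (if_neg hc) h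
  | α :: L, hL, e, w, h => by
    rw [countVecMultisets] at h
    obtain ⟨k, hk, hne⟩ := exists_ne_zero_of_sumUpTo_ne_zero h
    by_cases hkw : ∀ i, k * α i ≤ w i
    · rw [if_pos hkw] at hne
      have ih := sum_eq_of_countVecMultisets_ne_zero L (fun β hβ => hL β (List.mem_cons_of_mem _ hβ))
        _ _ hne
      have hα := hL α (List.mem_cons_self ..)
      have hsplit : ∑ i, w i = ∑ i, (w i - k * α i) + k * ∑ i, α i := by
        rw [Finset.mul_sum, ← Finset.sum_add_distrib]
        exact Finset.sum_congr rfl fun i _ => by have := hkw i; omega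
      rw [hsplit, ih, hα]
      have := Nat.sub_add_cancel hk
      nlinarith [this]
    · exact absurd (if_neg hkw) hne

/-- **Size bound**: `countVecMultisets L e w ≤ (|L|+1)^e`. [cite: DorflerIkenmeyerPanova2020, eq. (4.3) (arXiv p. 9)] -/
theorem countVecMultisets_le_pow :
    ∀ (L : List (Fin ℓ → ℕ)) (e : ℕ) (w : Fin ℓ → ℕ), countVecMultisets L e w ≤ (L.length + 1) ^ e
  | [], e, w => by
    rw [countVecMultisets, List.length_nil, Nat.zero_add, Nat.one_pow]
    split_ifs <;> simp
  | α :: L, 0, w => by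
    rw [countVecMultisets_cons_zero, pow_zero]
    exact le_trans (countVecMultisets_le_pow L 0 w) (by rw [pow_zero])
  | α :: L, e + 1, w => by
    rw [countVecMultisets_cons_succ, List.length_cons]
    have h1 := countVecMultisets_le_pow L (e + 1) w
    have h2 : (if ∀ i, α i ≤ w i then countVecMultisets (α :: L) e (fun i => w i - α i) else 0) ≤
        (L.length + 1 + 1) ^ e := by
      split_ifs
      · exact (countVecMultisets_le_pow (α :: L) e _).trans (by rw [List.length_cons])
      · exact Nat.zero_le _
    calc countVecMultisets L (e + 1) w + _ ≤ (L.length + 1) ^ (e + 1) + (L.length + 1 + 1) ^ e :=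
          Nat.add_le_add h1 h2
      _ ≤ (L.length + 1) * (L.length + 1 + 1) ^ e + (L.length + 1 + 1) ^ e := by
          apply Nat.add_le_add_right
          rw [pow_succ']
          exact Nat.mul_le_mul_left _ (Nat.pow_le_pow_left (Nat.le_succ _) e)
      _ = (L.length + 1 + 1) ^ (e + 1) := by ring

end CountLemmas

/-! ### The packed dynamic programme -/

section DP

/-- One composition step on the packed layers `1, …, d`, given the new layer below (`prev`):
`new_{e+1} = old_{e+1} + (new_e · P) mod M`. [folklore] -/
def dpStepTail (P M : ℕ) : List ℕ → ℕ → List ℕ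
  | [], _ => []
  | x :: xs, prev =>
    let y := x + prev * P % M
    y :: dpStepTail P M xs y

/-- One composition step on all packed layers (`new_0 = old_0`). [folklore] -/
def dpStep (P M : ℕ) : List ℕ → List ℕ
  | [] => []
  | x :: xs => x :: dpStepTail P M xs x

/-- The dynamic programme over a list of `4`-compositions: layers for `L` from layers for its tail,
shift `P = 2^{F·flat3 W α₀ α₁ α₂}`. [cite: DorflerIkenmeyerPanova2020, eq. (4.3) (arXiv p. 9)] -/
def dpRun (F M W : ℕ) : List (Fin 4 → ℕ) → List ℕ → List ℕ
  | [], T => T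
  | α :: L, T => dpStep (2 ^ (F * flat3 W (α 0) (α 1) (α 2))) M (dpRun F M W L T)

/-- The layers for the empty list of compositions: only the empty multiset, in layer `0` at the
origin. [cite: DorflerIkenmeyerPanova2020, eq. (4.3) (arXiv p. 9)] -/
def dpInit (d : ℕ) : List ℕ := 1 :: List.replicate d 0

/-- **The packed tables of four-letter monomial counts**: layer `e ≤ d` of `dpTables F D₀ n d` holds,
at flat position `flat3 (nd+1) w₀ w₁ w₂` (`w₀ < D₀`), the base-`2^F` digit
`countVecMultisets (weakComps 4 n) e (w₀,w₁,w₂,ne−w₀−w₁−w₂)` (`digitAt_dpTables`).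
[cite: DorflerIkenmeyerPanova2020, eq. (4.3) (arXiv p. 9)] -/
def dpTables (F D0 n d : ℕ) : List ℕ :=
  dpRun F (2 ^ (F * (D0 * (n * d + 1) * (n * d + 1)))) (n * d + 1) (weakComps 4 n) (dpInit d)

/-- The length of the layer list is preserved by a step. [folklore] -/
private theorem length_dpStepTail (P M : ℕ) : ∀ (xs : List ℕ) (prev : ℕ),
    (dpStepTail P M xs prev).length = xs.length
  | [], _ => rfl
  | x :: xs, prev => by
    show ((x + prev * P % M) :: dpStepTail P M xs (x + prev * P % M)).length = (x :: xs).length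
    rw [List.length_cons, List.length_cons, length_dpStepTail P M xs]

/-- The length of the layer list is preserved by a step. [folklore] -/
private theorem length_dpStep (P M : ℕ) : ∀ (T : List ℕ), (dpStep P M T).length = T.length
  | [] => rfl
  | x :: xs => by
    show (x :: dpStepTail P M xs x).length = _
    rw [List.length_cons, List.length_cons, length_dpStepTail]

/-- The first new layer produced by `dpStepTail`. [folklore] -/
private theorem dpStepTail_getD_zero (P M : ℕ) : ∀ (xs : List ℕ) (prev : ℕ), xs ≠ [] →
    (dpStepTail P M xs prev).getD 0 0 = xs.getD 0 0 + prev * P % M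
  | [], _, h => absurd rfl h
  | _ :: _, _, _ => rfl

/-- The recursion between consecutive new layers produced by `dpStepTail`. [folklore] -/
private theorem dpStepTail_getD_succ (P M : ℕ) : ∀ (xs : List ℕ) (prev j : ℕ), j + 1 < xs.length →
    (dpStepTail P M xs prev).getD (j + 1) 0 =
      xs.getD (j + 1) 0 + (dpStepTail P M xs prev).getD j 0 * P % M
  | [], _, _, h => absurd h (by simp)
  | x :: xs, prev, 0, h => by
    have hne : xs ≠ [] := by
      rintro rfl
      simp at h
    show (dpStepTail P M xs _).getD 0 0 = _
    rw [dpStepTail_getD_zero P M xs _ hne]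
    rfl
  | x :: xs, prev, j + 1, h => by
    show (dpStepTail P M xs _).getD (j + 1) 0 = xs.getD (j + 1) 0 + (dpStepTail P M xs _).getD j 0 * P % M
    exact dpStepTail_getD_succ P M xs _ j (by rw [List.length_cons] at h; omega)

/-- Layer `0` is unchanged by a step. [folklore] -/
private theorem dpStep_getD_zero (P M : ℕ) : ∀ (T : List ℕ), (dpStep P M T).getD 0 0 = T.getD 0 0
  | [] => rfl
  | _ :: _ => rfl

/-- **The step recursion** `new_{e+1} = old_{e+1} + (new_e · P) mod M`. [folklore] -/
private theorem dpStep_getD_succ (P M : ℕ) : ∀ (T : List ℕ) (e : ℕ), e + 1 < T.length →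
    (dpStep P M T).getD (e + 1) 0 = T.getD (e + 1) 0 + (dpStep P M T).getD e 0 * P % M
  | [], _, h => absurd h (by simp)
  | x :: xs, 0, h => by
    have hne : xs ≠ [] := by
      rintro rfl
      simp at h
    show (dpStepTail P M xs x).getD 0 0 = xs.getD 0 0 + x * P % M
    exact dpStepTail_getD_zero P M xs x hne
  | x :: xs, e + 1, h => by
    show (dpStepTail P M xs x).getD (e + 1) 0 = xs.getD (e + 1) 0 + (dpStepTail P M xs x).getD e 0 * P % M
    exact dpStepTail_getD_succ P M xs x e (by rw [List.length_cons] at h; omega)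

end DP

/-! ### Correctness of the dynamic programme -/

section Correctness

/-- The count stored at cell `(w₀,w₁,w₂)` of layer `e`: the fourth coordinate is forced by the total
degree `ne`. [cite: DorflerIkenmeyerPanova2020, eq. (4.3) (arXiv p. 9)] -/
def cvm4 (L : List (Fin 4 → ℕ)) (n e w0 w1 w2 : ℕ) : ℕ :=
  countVecMultisets L e ![w0, w1, w2, n * e - (w0 + w1 + w2)]

/-- A packed layer `X` represents layer `e` of the counts for `L`: its base-`2^F` digits are the
counts `cvm4` inside the outer cut `D₀` and vanish beyond. [cite: DorflerIkenmeyerPanova2020, eq. (4.3) (arXiv p. 9)] -/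
def LayerOK (F D0 W n : ℕ) (L : List (Fin 4 → ℕ)) (e X : ℕ) : Prop :=
  ∀ w0 w1 w2, w1 < W → w2 < W →
    digitAt F X (flat3 W w0 w1 w2) = if w0 < D0 then cvm4 L n e w0 w1 w2 else 0

/-- All `d+1` packed layers represent the counts for `L`. [cite: DorflerIkenmeyerPanova2020, eq. (4.3) (arXiv p. 9)] -/
def TablesOK (F D0 W n d : ℕ) (L : List (Fin 4 → ℕ)) (T : List ℕ) : Prop :=
  T.length = d + 1 ∧ ∀ e ≤ d, LayerOK F D0 W n L e (T.getD e 0)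

/-- `∀ i : Fin 4` as a conjunction. [folklore] -/
private theorem forall_fin_four {P : Fin 4 → Prop} : (∀ i, P i) ↔ P 0 ∧ P 1 ∧ P 2 ∧ P 3 := by
  simp only [Fin.forall_fin_succ, IsEmpty.forall_iff, and_true]
  rfl

/-- The sum of a `4`-vector. [folklore] -/
private theorem sum_vec_four (a b c d : ℕ) : ∑ i, (![a, b, c, d] : Fin 4 → ℕ) i = a + b + c + d := by
  rw [Fin.sum_univ_four]
  rfl

/-- Componentwise subtraction of `4`-vectors. [folklore] -/
private theorem vec_four_sub (a b c d : ℕ) (α : Fin 4 → ℕ) :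
    (fun i => (![a, b, c, d] : Fin 4 → ℕ) i - α i) = ![a - α 0, b - α 1, c - α 2, d - α 3] := by
  funext i
  fin_cases i <;> rfl

/-- The initial layers represent the counts for the empty composition list. [cite: DorflerIkenmeyerPanova2020, eq. (4.3) (arXiv p. 9)] -/
theorem tablesOK_dpInit {F D0 W n : ℕ} (hF : 0 < F) (hD0 : 0 < D0) (hW : 0 < W) (d : ℕ) :
    TablesOK F D0 W n d [] (dpInit d) := by
  refine ⟨by simp [dpInit], fun e he w0 w1 w2 h1 h2 => ?_⟩
  unfold cvm4
  rw [countVecMultisets]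
  rcases e with _ | e
  · have hget : (dpInit d).getD 0 0 = 1 := by simp [dpInit]
    rw [hget, digitAt_one hF]
    have hzero : flat3 W w0 w1 w2 = 0 ↔ w0 = 0 ∧ w1 = 0 ∧ w2 = 0 := by
      unfold flat3
      constructor
      · intro h
        have h2' : w2 = 0 := by omega
        have h01 : (w0 * W + w1) * W = 0 := by omega
        rcases Nat.mul_eq_zero.mp h01 with h01 | hW0
        · have h1' : w1 = 0 := by omega
          have h0 : w0 * W = 0 := by omega
          rcases Nat.mul_eq_zero.mp h0 with h0 | hW0
          · exact ⟨h0, h1', h2'⟩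
          · omega
        · omega
      · rintro ⟨rfl, rfl, rfl⟩; simp
    have hvec : (![w0, w1, w2, n * 0 - (w0 + w1 + w2)] : Fin 4 → ℕ) = 0 ↔ w0 = 0 ∧ w1 = 0 ∧ w2 = 0 := by
      constructor
      · intro h
        have h0 := congrFun h 0
        have h1 := congrFun h 1
        have h2 := congrFun h 2
        simp at h0 h1 h2
        exact ⟨h0, h1, h2⟩
      · rintro ⟨rfl, rfl, rfl⟩
        funext i
        fin_cases i <;> simp
    by_cases hz : w0 = 0 ∧ w1 = 0 ∧ w2 = 0
    · rw [if_pos (hzero.mpr hz), if_pos (by omega : w0 < D0), if_pos ⟨rfl, hvec.mpr hz⟩]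
    · rw [if_neg (mt hzero.mp hz)]
      split_ifs with h0 h3
      · exact absurd (hvec.mp h3.2) hz
      · rfl
      · rfl
  · have hget : (dpInit d).getD (e + 1) 0 = 0 := by
      unfold dpInit
      rw [List.getD_cons_succ, List.getD_eq_getElem?_getD, List.getElem?_replicate]
      split_ifs <;> rfl
    rw [hget, digitAt_zero]
    split_ifs with h0 h3
    · exact False.elim (by simpa using h3.1)
    · rfl
    · rfl

/-- **The shifted digit is the second summand of the geometric step.** For a cell `w` inside the cut
and the new layer `e` (`X`, for `α :: L`): the digit of `X` at `flat3 w − flat3 α` (zero if the shift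
does not fit) is `[α ≤ w] · countVecMultisets (α :: L) e (w − α)`; the flat shift never wraps because a
nonzero count forces coordinates `≤ ne ≤ n(d−1)`, and `n(d−1) + n < W`.
[cite: DorflerIkenmeyerPanova2020, eq. (4.3) (arXiv p. 9)] -/
theorem digitAt_shift_eq {F D0 W n d e : ℕ} (hW : n * d < W) (α : Fin 4 → ℕ) (L : List (Fin 4 → ℕ))
    (hα : ∑ i, α i = n) (hL : ∀ β ∈ L, ∑ i, β i = n) (he : e + 1 ≤ d) {X : ℕ}
    (hX : LayerOK F D0 W n (α :: L) e X) {w0 w1 w2 : ℕ} (hw0 : w0 < D0) (h1 : w1 < W) (h2 : w2 < W) :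
    (if flat3 W (α 0) (α 1) (α 2) ≤ flat3 W w0 w1 w2
      then digitAt F X (flat3 W w0 w1 w2 - flat3 W (α 0) (α 1) (α 2)) else 0) =
    (if ∀ i, α i ≤ (![w0, w1, w2, n * (e + 1) - (w0 + w1 + w2)] : Fin 4 → ℕ) i
      then countVecMultisets (α :: L) e
        (fun i => (![w0, w1, w2, n * (e + 1) - (w0 + w1 + w2)] : Fin 4 → ℕ) i - α i) else 0) := by
  have hα' : α 0 + α 1 + α 2 + α 3 = n := by rw [← hα, Fin.sum_univ_four]
  have hne : n * e + n ≤ n * d := by rw [← Nat.mul_succ]; exact Nat.mul_le_mul_left n he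
  have hWpos : 0 < W := by omega
  have hαL : ∀ β ∈ α :: L, ∑ i, β i = n := by
    intro β hβ
    rcases List.mem_cons.mp hβ with rfl | hβ
    · exact hα
    · exact hL β hβ
  rw [vec_four_sub]
  split_ifs with hs hc hc
  · -- the shift fits and `α ≤ w`: same cell
    obtain ⟨hc0, hc1, hc2, hc3⟩ := forall_fin_four.mp hc
    change α 0 ≤ w0 at hc0; change α 1 ≤ w1 at hc1; change α 2 ≤ w2 at hc2
    change α 3 ≤ n * (e + 1) - (w0 + w1 + w2) at hc3
    have hp : flat3 W w0 w1 w2 - flat3 W (α 0) (α 1) (α 2) =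
        flat3 W (w0 - α 0) (w1 - α 1) (w2 - α 2) := by
      apply Nat.sub_eq_of_eq_add
      rw [← flat3_add]
      congr 1 <;> omega
    rw [hp, hX _ _ _ (by omega) (by omega), if_pos (by omega)]
    unfold cvm4
    change countVecMultisets (α :: L) e ![w0 - α 0, w1 - α 1, w2 - α 2, n * e - (w0 - α 0 + (w1 - α 1) + (w2 - α 2))] =
      countVecMultisets (α :: L) e ![w0 - α 0, w1 - α 1, w2 - α 2, n * (e + 1) - (w0 + w1 + w2) - α 3]
    have h4 : n * e - (w0 - α 0 + (w1 - α 1) + (w2 - α 2)) = n * (e + 1) - (w0 + w1 + w2) - α 3 := by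
      rw [Nat.mul_succ] at hc3 ⊢
      omega
    rw [h4]
  · -- the shift fits but `α ≰ w`: the source cell is unreachable
    by_contra hne0
    obtain ⟨q, hq⟩ : ∃ q, flat3 W w0 w1 w2 = q + flat3 W (α 0) (α 1) (α 2) :=
      ⟨_, (Nat.sub_add_cancel hs).symm⟩
    have hpq : flat3 W w0 w1 w2 - flat3 W (α 0) (α 1) (α 2) = q := by omega
    rw [hpq] at hne0
    have hdec := flat3_decode W q
    have hx1lt : q / W % W < W := Nat.mod_lt _ hWpos
    have hx2lt : q % W < W := Nat.mod_lt _ hWpos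
    generalize hx0 : q / W / W = x0 at hdec
    generalize hx1 : q / W % W = x1 at hdec hx1lt
    generalize hx2 : q % W = x2 at hdec hx2lt
    subst hdec
    rw [hX x0 x1 x2 hx1lt hx2lt] at hne0
    have hx0 : x0 < D0 := by
      by_contra h
      exact hne0 (if_neg h)
    rw [if_pos hx0] at hne0
    unfold cvm4 at hne0
    have htot := sum_eq_of_countVecMultisets_ne_zero (α :: L) hαL e _ hne0
    rw [sum_vec_four] at htot
    -- linearise `n * e`
    generalize hN : n * e = N at htot hne
    -- no wrap: the source coordinates plus `α` stay below `W`
    have hs1 : x1 + α 1 < W := by omega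
    have hs2 : x2 + α 2 < W := by omega
    have hpq' : flat3 W w0 w1 w2 = flat3 W (x0 + α 0) (x1 + α 1) (x2 + α 2) := by
      rw [flat3_add]; exact hq
    obtain ⟨e0, e1, e2⟩ := flat3_inj h1 h2 hs1 hs2 hpq'
    apply hc
    refine forall_fin_four.mpr ⟨?_, ?_, ?_, ?_⟩
    · change α 0 ≤ w0; omega
    · change α 1 ≤ w1; omega
    · change α 2 ≤ w2; omega
    · change α 3 ≤ n * (e + 1) - (w0 + w1 + w2)
      rw [Nat.mul_succ, hN]
      omega
  · -- the shift does not fit but `α ≤ w`: impossible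
    exfalso
    obtain ⟨hc0, hc1, hc2, -⟩ := forall_fin_four.mp hc
    change α 0 ≤ w0 at hc0; change α 1 ≤ w1 at hc1; change α 2 ≤ w2 at hc2
    apply hs
    have : flat3 W w0 w1 w2 = flat3 W (w0 - α 0) (w1 - α 1) (w2 - α 2) + flat3 W (α 0) (α 1) (α 2) := by
      rw [← flat3_add]
      congr 1 <;> omega
    omega
  · rfl

/-- **One step of the dynamic programme preserves the representation invariant.**
[cite: DorflerIkenmeyerPanova2020, eq. (4.3) (arXiv p. 9)] -/
theorem tablesOK_dpStep {F D0 W n d : ℕ} (hW : n * d < W) (α : Fin 4 → ℕ)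
    (L : List (Fin 4 → ℕ)) (hα : ∑ i, α i = n) (hL : ∀ β ∈ L, ∑ i, β i = n)
    (hbound : (L.length + 2) ^ d < 2 ^ F) {T : List ℕ} (hT : TablesOK F D0 W n d L T) :
    TablesOK F D0 W n d (α :: L)
      (dpStep (2 ^ (F * flat3 W (α 0) (α 1) (α 2))) (2 ^ (F * (D0 * W * W))) T) := by
  obtain ⟨hlen, hlay⟩ := hT
  have hWpos : 0 < W := by omega
  refine ⟨by rw [length_dpStep, hlen], ?_⟩
  intro e
  induction e with
  | zero =>
    intro _ w0 w1 w2 h1 h2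
    rw [dpStep_getD_zero, hlay 0 (Nat.zero_le _) w0 w1 w2 h1 h2]
    unfold cvm4
    rw [countVecMultisets_cons_zero]
  | succ e ih =>
    intro he
    have ihe := ih (Nat.le_of_succ_le he)
    rw [dpStep_getD_succ _ _ T e (by rw [hlen]; omega)]
    -- the two summands: `A` = old layer `e+1`, `C` = shifted, truncated new layer `e`
    set A := T.getD (e + 1) 0 with hA
    set C := (dpStep (2 ^ (F * flat3 W (α 0) (α 1) (α 2))) (2 ^ (F * (D0 * W * W))) T).getD e 0 *
      2 ^ (F * flat3 W (α 0) (α 1) (α 2)) % 2 ^ (F * (D0 * W * W)) with hC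
    have key : ∀ w0 w1 w2, w1 < W → w2 < W →
        digitAt F A (flat3 W w0 w1 w2) + digitAt F C (flat3 W w0 w1 w2) =
          if w0 < D0 then cvm4 (α :: L) n (e + 1) w0 w1 w2 else 0 := by
      intro w0 w1 w2 h1 h2
      rw [hA, hlay (e + 1) he w0 w1 w2 h1 h2, hC, digitAt_mod_pow, digitAt_mul_pow]
      by_cases hw0 : w0 < D0
      · rw [if_pos hw0, if_pos hw0, if_pos ((flat3_lt_iff h1 h2).mpr hw0)]
        unfold cvm4
        rw [countVecMultisets_cons_succ]
        congr 1
        exact digitAt_shift_eq hW α L hα hL he ihe hw0 h1 h2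
      · rw [if_neg hw0, if_neg hw0, if_neg (mt (flat3_lt_iff (D0 := D0) h1 h2).mp hw0)]
    have nocarry : ∀ j, digitAt F A j + digitAt F C j < 2 ^ F := by
      intro j
      rw [← flat3_decode W j, key _ _ _ (Nat.mod_lt _ hWpos) (Nat.mod_lt _ hWpos)]
      split_ifs
      · unfold cvm4
        refine lt_of_le_of_lt ((countVecMultisets_le_pow _ _ _).trans ?_) hbound
        rw [List.length_cons]
        exact Nat.pow_le_pow_right (Nat.succ_pos _) he
      · exact Nat.two_pow_pos F
    intro w0 w1 w2 h1 h2
    rw [digitAt_add A C nocarry, key w0 w1 w2 h1 h2]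

/-- **The dynamic programme represents the counts** for every list of compositions of `n`.
[cite: DorflerIkenmeyerPanova2020, eq. (4.3) (arXiv p. 9)] -/
theorem tablesOK_dpRun {F D0 W n d : ℕ} (hF : 0 < F) (hD0 : 0 < D0) (hW : n * d < W) :
    ∀ (L : List (Fin 4 → ℕ)), (∀ β ∈ L, ∑ i, β i = n) → (L.length + 1) ^ d < 2 ^ F →
      TablesOK F D0 W n d L (dpRun F (2 ^ (F * (D0 * W * W))) W L (dpInit d))
  | [], _, _ => tablesOK_dpInit hF hD0 (by omega) d
  | α :: L, hL, hb => by
    rw [dpRun]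
    refine tablesOK_dpStep hW α L (hL α List.mem_cons_self)
      (fun β hβ => hL β (List.mem_cons_of_mem _ hβ)) (by rw [List.length_cons] at hb; exact hb)
      (tablesOK_dpRun hF hD0 hW L (fun β hβ => hL β (List.mem_cons_of_mem _ hβ)) (lt_of_le_of_lt ?_ hb))
    rw [List.length_cons]
    exact Nat.pow_le_pow_left (Nat.le_succ _) d

/-- **Correctness of `dpTables`**: inside the cut, the digits of layer `e` are the four-letter
monomial counts of t07's recursion `countVecMultisets (weakComps 4 n)`.
[cite: DorflerIkenmeyerPanova2020, eq. (4.3) (arXiv p. 9)] -/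
theorem digitAt_dpTables {F D0 n d : ℕ} (hF : ((weakComps 4 n).length + 1) ^ d < 2 ^ F) (hD0 : 0 < D0)
    {e : ℕ} (he : e ≤ d) {w0 w1 w2 : ℕ} (hw0 : w0 < D0) (hw1 : w1 < n * d + 1)
    (hw2 : w2 < n * d + 1) :
    digitAt F ((dpTables F D0 n d).getD e 0) (flat3 (n * d + 1) w0 w1 w2) =
      countVecMultisets (weakComps 4 n) e ![w0, w1, w2, n * e - (w0 + w1 + w2)] := by
  have hF0 : 0 < F := by
    refine Nat.pos_of_ne_zero fun h => ?_
    rw [h, pow_zero] at hF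
    exact absurd hF (not_lt.mpr (Nat.one_le_pow _ _ (Nat.succ_pos _)))
  obtain ⟨-, hlay⟩ := tablesOK_dpRun hF0 hD0 (Nat.lt_succ_self _) (weakComps 4 n)
    (fun β hβ => mem_weakComps_iff.mp hβ) hF
  have h := hlay e he w0 w1 w2 hw1 hw2
  rw [if_pos hw0] at h
  exact h

/-- **`c_ν(d,n)` for four letters, read off the packed table**: for `ν` of size `nd` inside the cut,
`dipMonomialCount ν d n` is the digit of the last layer of `dpTables` at `flat3 (nd+1) ν₀ ν₁ ν₂`.
[cite: DorflerIkenmeyerPanova2020, eq. (4.3) (arXiv p. 9)] -/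
theorem dipMonomialCount_eq_digitAt_dpTables {F D0 n d : ℕ} (ν : Fin 4 → ℕ)
    (hν : ∑ i, ν i = n * d) (hν0 : ν 0 < D0) (hν1 : ν 1 < n * d + 1) (hν2 : ν 2 < n * d + 1)
    (hF : ((weakComps 4 n).length + 1) ^ d < 2 ^ F) :
    dipMonomialCount ν d n = digitAt F ((dpTables F D0 n d).getD d 0) (flat3 (n * d + 1) (ν 0) (ν 1) (ν 2)) := by
  rw [dipMonomialCount_eq_eval, dipMonomialCountEval,
    digitAt_dpTables hF (by omega) le_rfl hν0 hν1 hν2]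
  congr 1
  rw [Fin.sum_univ_four] at hν
  funext i
  fin_cases i
  · rfl
  · rfl
  · rfl
  · change ν 3 = n * d - (ν 0 + ν 1 + ν 2)
    omega

end Correctness

/-! ### Plethysm coefficients of four-row partitions through the packed table -/

section FourRows

open _root_.Literature.NumberTheory.DiophantineGeometry

/-- A weakly decreasing quadruple is antitone. [cite: DorflerIkenmeyerPanova2020, §2 (arXiv p. 3: `m`-partitions)] -/
private theorem antitone_fin_four {μ : Fin 4 → ℕ} (h10 : μ 1 ≤ μ 0) (h21 : μ 2 ≤ μ 1) (h32 : μ 3 ≤ μ 2) :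
    Antitone μ := by
  intro i j hij
  fin_cases i <;> fin_cases j <;> simp at hij ⊢ <;> omega

/-- **(4.4) for four rows with every monomial count read off ONE packed table**: for a `4`-partition
`λ` of `dn` (`n ≥ 1`, `λ₁ + 2 ≤ nd`), `a_λ(d[n]) = Σ_{π ∈ 𝔖₄} sgn(π) c_{λ+π−id}(d,n)` with
`c_ν(d,n)` the digit of layer `d` of `dpTables F (λ₀+4) n d` at `flat3 (nd+1) ν₀ ν₁ ν₂`, any base exponent
`F` with `(#weakComps + 1)^d < 2^F`. The right-hand side is kernel-evaluable (`decide +kernel`).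
[cite: DorflerIkenmeyerPanova2020, eqs. (4.3)–(4.4) (arXiv p. 9)] -/
theorem plethysmCoeff_fin_four_cast_eq_dp (lam : Fin 4 → ℕ) {n d F : ℕ} (hn : 0 < n)
    (h10 : lam 1 ≤ lam 0) (h21 : lam 2 ≤ lam 1) (h32 : lam 3 ≤ lam 2) (hsum : ∑ i, lam i = d * n)
    (hroom : lam 1 + 2 ≤ n * d) (hF : ((weakComps 4 n).length + 1) ^ d < 2 ^ F) :
    (plethysmCoeff ℂ (Fin 4) n (rowDual lam) : ℤ) =
      ∑ π : Equiv.Perm (Fin 4), ((Equiv.Perm.sign π : ℤˣ) : ℤ) *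
        (if ∀ i : Fin 4, (i : ℕ) ≤ lam i + (π i : ℕ)
          then (digitAt F ((dpTables F (lam 0 + 4) n d).getD d 0)
            (flat3 (n * d + 1) (lam 0 + (π 0 : ℕ) - 0) (lam 1 + (π 1 : ℕ) - 1) (lam 2 + (π 2 : ℕ) - 2)) : ℤ)
          else 0) := by
  rw [DIP20_eq_4_4_holds 4 n d lam hn (antitone_fin_four h10 h21 h32) hsum]
  refine Finset.sum_congr rfl fun π _ => ?_
  split_ifs with hc
  · congr 1
    have hπsum : ∑ i : Fin 4, ((π i : Fin 4) : ℕ) = ∑ i : Fin 4, (i : ℕ) :=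
      Equiv.sum_comp π (fun i : Fin 4 => (i : ℕ))
    have hνsum : ∑ i : Fin 4, (lam i + (π i : ℕ) - (i : ℕ)) = n * d := by
      have h1 : ∑ i : Fin 4, (lam i + (π i : ℕ) - (i : ℕ)) + ∑ i : Fin 4, (i : ℕ) =
          ∑ i : Fin 4, lam i + ∑ i : Fin 4, ((π i : Fin 4) : ℕ) := by
        rw [← Finset.sum_add_distrib, ← Finset.sum_add_distrib]
        exact Finset.sum_congr rfl fun i _ => Nat.sub_add_cancel (hc i)
      rw [hπsum, hsum] at h1
      have := Nat.eq_sub_of_add_eq h1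
      rw [this, Nat.add_sub_cancel, Nat.mul_comm]
    have hπ0 : ((π 0 : Fin 4) : ℕ) < 4 := (π 0).isLt
    have hπ1 : ((π 1 : Fin 4) : ℕ) < 4 := (π 1).isLt
    have hπ2 : ((π 2 : Fin 4) : ℕ) < 4 := (π 2).isLt
    exact_mod_cast dipMonomialCount_eq_digitAt_dpTables (fun i : Fin 4 => lam i + (π i : ℕ) - (i : ℕ))
      hνsum (by change lam 0 + _ - 0 < lam 0 + 4; omega) (by change lam 1 + _ - 1 < n * d + 1; omega)
      (by change lam 2 + _ - 2 < n * d + 1; omega) hF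
  · rfl

end FourRows


/-! ## Part II. The MASKED engine: a tight box on the three small coordinates

For the tails of Lemma 3.13 the first coordinate is huge and the other three are tiny; the dense layout of
Part I (inner widths `nd+1`) is then hopeless. Part II stores, per layer, only the box
`w₁ < D₁, w₂ < D₂, w₃ < D₃` of the three SMALL coordinates (the first one is implicit), with padding `P ≥ n`
on the two inner axes so that one shift never wraps, and clears the padding after every shift by one
`Nat.land` with the box mask (`boxMask`, built by `packDigits`). Step: `new_{e+1} = old_{e+1} +
((new_e · 2^{F s(α)}) &&& M)` — again three GMP-accelerated operations per (composition, layer).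
Correctness: `digitAt_dpTablesM`, `dipMonomialCount_eq_digitAt_dpTablesM`; packaged (4.4) right-hand side:
`dip44_rhs_eq_dpM` (no antitonicity needed) and `plethysmCoeff_fin_four_cast_eq_dpM`. -/

/-! ### Digits of bitwise `and`, and packing a digit function -/

section MaskedDigits

/-- Digits are `< 2^F`. [folklore] -/
private theorem digitAt_lt (F N i : ℕ) : digitAt F N i < 2 ^ F :=
  Nat.mod_lt _ (Nat.two_pow_pos _)

/-- The bits of a digit. [folklore] -/
private theorem testBit_digitAt (F N p i : ℕ) :
    (digitAt F N p).testBit i = (decide (i < F) && N.testBit (F * p + i)) := by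
  unfold digitAt
  rw [Nat.testBit_mod_two_pow, Nat.testBit_div_two_pow, Nat.add_comm]

/-- **Digits of a bitwise `and`** are the `and`s of the digits. [folklore] -/
private theorem digitAt_land (F x y p : ℕ) : digitAt F (x &&& y) p = digitAt F x p &&& digitAt F y p := by
  apply Nat.eq_of_testBit_eq
  intro i
  rw [Nat.testBit_land, testBit_digitAt, testBit_digitAt, testBit_digitAt, Nat.testBit_land]
  cases decide (i < F) <;> simp

/-- `and` with the all-ones digit is the identity on digits. [folklore] -/
private theorem land_ones_of_lt {F y : ℕ} (hy : y < 2 ^ F) : y &&& (2 ^ F - 1) = y := by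
  rw [Nat.and_two_pow_sub_one_eq_mod, Nat.mod_eq_of_lt hy]

/-- The digits of a one-digit number. [folklore] -/
private theorem digitAt_of_lt {F y : ℕ} (hy : y < 2 ^ F) (j : ℕ) : digitAt F y j = if j = 0 then y else 0 := by
  unfold digitAt
  split_ifs with hj
  · subst hj
    simp [Nat.mod_eq_of_lt hy]
  · have hle : 2 ^ F ≤ 2 ^ (F * j) :=
      Nat.pow_le_pow_right (by norm_num) (Nat.le_mul_of_pos_right F (Nat.pos_of_ne_zero hj))
    rw [Nat.div_eq_of_lt (lt_of_lt_of_le hy hle), Nat.zero_mod]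

/-- **Packing a digit function**: `Σ_{p<K} f(p)·2^{Fp}`. [folklore] -/
def packDigits (F : ℕ) (f : ℕ → ℕ) : ℕ → ℕ
  | 0 => 0
  | K + 1 => packDigits F f K + f K * 2 ^ (F * K)

/-- The digits of a packed digit function are the function (below `K`). [folklore] -/
private theorem digitAt_packDigits {F : ℕ} {f : ℕ → ℕ} (hf : ∀ p, f p < 2 ^ F) :
    ∀ (K p : ℕ), digitAt F (packDigits F f K) p = if p < K then f p else 0
  | 0, p => by simp [packDigits, digitAt_zero]
  | K + 1, p => by
    rw [packDigits]
    have hA : ∀ q, digitAt F (packDigits F f K) q = if q < K then f q else 0 := digitAt_packDigits hf K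
    have hC : ∀ q, digitAt F (f K * 2 ^ (F * K)) q = if q = K then f K else 0 := by
      intro q
      rw [digitAt_mul_pow]
      by_cases hq : K ≤ q
      · rw [if_pos hq, digitAt_of_lt (hf K)]
        by_cases hqK : q = K
        · rw [if_pos (by omega), if_pos hqK]
        · rw [if_neg (by omega), if_neg hqK]
      · rw [if_neg hq, if_neg (by omega)]
    have nocarry : ∀ q, digitAt F (packDigits F f K) q + digitAt F (f K * 2 ^ (F * K)) q < 2 ^ F := by
      intro q
      rw [hA, hC]
      have := hf q
      have := hf K
      split_ifs <;> omega
    rw [digitAt_add _ _ nocarry, hA, hC]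
    rcases Nat.lt_trichotomy p K with h | h | h
    · rw [if_pos h, if_neg (Nat.ne_of_lt h), if_pos (Nat.lt_succ_of_lt h), Nat.add_zero]
    · subst h
      rw [if_neg (lt_irrefl _), if_pos rfl, if_pos (Nat.lt_succ_self _), Nat.zero_add]
    · rw [if_neg (by omega), if_neg (by omega), if_neg (by omega)]

end MaskedDigits

/-! ### The flat index with two inner widths -/

section FlatIndexM

/-- The flat position of the cell `(w₁,w₂,w₃)` with inner widths `R₂, R₃`. [folklore] -/
def boxIdx (R2 R3 w1 w2 w3 : ℕ) : ℕ := (w1 * R2 + w2) * R3 + w3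

/-- The flat index is additive. [folklore] -/
private theorem boxIdx_add (R2 R3 a1 a2 a3 b1 b2 b3 : ℕ) :
    boxIdx R2 R3 (a1 + b1) (a2 + b2) (a3 + b3) = boxIdx R2 R3 a1 a2 a3 + boxIdx R2 R3 b1 b2 b3 := by
  unfold boxIdx; ring

/-- Every position decodes. [folklore] -/
private theorem boxIdx_decode (R2 R3 p : ℕ) :
    boxIdx R2 R3 (p / R3 / R2) (p / R3 % R2) (p % R3) = p := by
  unfold boxIdx
  have h1 := Nat.div_add_mod (p / R3) R2
  have h2 := Nat.div_add_mod p R3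
  rw [mul_comm (p / R3 / R2), h1, mul_comm, h2]

/-- The coordinates are recovered from the flat index. [folklore] -/
private theorem boxIdx_div_mod {R2 R3 w1 w2 w3 : ℕ} (h2 : w2 < R2) (h3 : w3 < R3) :
    boxIdx R2 R3 w1 w2 w3 / R3 / R2 = w1 ∧ boxIdx R2 R3 w1 w2 w3 / R3 % R2 = w2 ∧
      boxIdx R2 R3 w1 w2 w3 % R3 = w3 := by
  have hR2 : 0 < R2 := by omega
  have hR3 : 0 < R3 := by omega
  have hq : boxIdx R2 R3 w1 w2 w3 / R3 = w1 * R2 + w2 := by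
    unfold boxIdx
    rw [Nat.add_comm, Nat.add_mul_div_right _ _ hR3, Nat.div_eq_of_lt h3, Nat.zero_add]
  refine ⟨?_, ?_, ?_⟩
  · rw [hq, Nat.add_comm, Nat.add_mul_div_right _ _ hR2, Nat.div_eq_of_lt h2, Nat.zero_add]
  · rw [hq, Nat.add_comm, Nat.add_mul_mod_self_right, Nat.mod_eq_of_lt h2]
  · unfold boxIdx
    rw [Nat.add_comm, Nat.add_mul_mod_self_right, Nat.mod_eq_of_lt h3]

/-- The flat index is injective on cells with in-range inner coordinates. [folklore] -/
private theorem boxIdx_inj {R2 R3 a1 a2 a3 b1 b2 b3 : ℕ} (ha2 : a2 < R2) (ha3 : a3 < R3) (hb2 : b2 < R2)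
    (hb3 : b3 < R3) (h : boxIdx R2 R3 a1 a2 a3 = boxIdx R2 R3 b1 b2 b3) :
    a1 = b1 ∧ a2 = b2 ∧ a3 = b3 := by
  obtain ⟨e1, e2, e3⟩ := boxIdx_div_mod (w1 := a1) ha2 ha3
  obtain ⟨f1, f2, f3⟩ := boxIdx_div_mod (w1 := b1) hb2 hb3
  exact ⟨by rw [← e1, h, f1], by rw [← e2, h, f2], by rw [← e3, h, f3]⟩

/-- A cell with first coordinate below `D₁` has flat index `< D₁R₂R₃`, and conversely.
[folklore] -/
private theorem boxIdx_lt_iff {R2 R3 D1 w1 w2 w3 : ℕ} (h2 : w2 < R2) (h3 : w3 < R3) :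
    boxIdx R2 R3 w1 w2 w3 < D1 * R2 * R3 ↔ w1 < D1 := by
  unfold boxIdx
  constructor
  · intro h
    by_contra hc
    have : D1 * R2 * R3 ≤ (w1 * R2 + w2) * R3 + w3 := by
      have : D1 * R2 ≤ w1 * R2 + w2 := le_trans (Nat.mul_le_mul_right R2 (not_lt.mp hc)) (Nat.le_add_right _ _)
      exact le_trans (Nat.mul_le_mul_right R3 this) (Nat.le_add_right _ _)
    omega
  · intro h
    have h01 : w1 * R2 + w2 < (w1 + 1) * R2 := by rw [Nat.succ_mul]; omega
    have : (w1 * R2 + w2) * R3 + w3 < (w1 * R2 + w2 + 1) * R3 := by rw [Nat.succ_mul]; omega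
    calc (w1 * R2 + w2) * R3 + w3 < (w1 * R2 + w2 + 1) * R3 := this
      _ ≤ (w1 + 1) * R2 * R3 := Nat.mul_le_mul_right R3 h01
      _ ≤ D1 * R2 * R3 := Nat.mul_le_mul_right R3 (Nat.mul_le_mul_right R2 h)

end FlatIndexM

/-! ### The masked dynamic programme -/

section DPM

/-- **The box mask**: all-ones digits exactly at the cells `w₁ < D₁, w₂ < D₂, w₃ < D₃` (inner widths
`R₂, R₃`). [folklore] -/
def boxMask (F D1 D2 D3 R2 R3 : ℕ) : ℕ :=
  packDigits F (fun p => if p / R3 / R2 < D1 ∧ p / R3 % R2 < D2 ∧ p % R3 < D3 then 2 ^ F - 1 else 0)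
    (D1 * R2 * R3)

/-- One composition step on the packed layers `1, …, d` (masked): `new_{e+1} = old_{e+1} +
((new_e · P) &&& M)`. [folklore] -/
def dpStepMTail (P M : ℕ) : List ℕ → ℕ → List ℕ
  | [], _ => []
  | x :: xs, prev =>
    let y := x + (prev * P &&& M)
    y :: dpStepMTail P M xs y

/-- One masked composition step on all packed layers (`new_0 = old_0`). [folklore] -/
def dpStepM (P M : ℕ) : List ℕ → List ℕ
  | [] => []
  | x :: xs => x :: dpStepMTail P M xs x

/-- The masked dynamic programme over a list of `4`-compositions (shift by the three SMALL coordinates).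
[cite: DorflerIkenmeyerPanova2020, eq. (4.3) (arXiv p. 9)] -/
def dpRunM (F M R2 R3 : ℕ) : List (Fin 4 → ℕ) → List ℕ → List ℕ
  | [], T => T
  | α :: L, T => dpStepM (2 ^ (F * boxIdx R2 R3 (α 1) (α 2) (α 3))) M (dpRunM F M R2 R3 L T)

/-- **The masked packed tables of four-letter monomial counts**: layer `e ≤ d` of
`dpTablesM F D₁ D₂ D₃ P n d` holds, at flat position `boxIdx (D₂+P) (D₃+P) w₁ w₂ w₃` (`wᵢ < Dᵢ`), the digit
`countVecMultisets (weakComps 4 n) e (ne−w₁−w₂−w₃, w₁, w₂, w₃)` (`digitAt_dpTablesM`; padding `P ≥ n`).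
[cite: DorflerIkenmeyerPanova2020, eq. (4.3) (arXiv p. 9)] -/
def dpTablesM (F D1 D2 D3 P n d : ℕ) : List ℕ :=
  dpRunM F (boxMask F D1 D2 D3 (D2 + P) (D3 + P)) (D2 + P) (D3 + P) (weakComps 4 n) (dpInit d)

/-- The length of the layer list is preserved by a masked step. [folklore] -/
private theorem length_dpStepMTail (P M : ℕ) : ∀ (xs : List ℕ) (prev : ℕ),
    (dpStepMTail P M xs prev).length = xs.length
  | [], _ => rfl
  | x :: xs, prev => by
    show ((x + (prev * P &&& M)) :: dpStepMTail P M xs (x + (prev * P &&& M))).length = (x :: xs).length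
    rw [List.length_cons, List.length_cons, length_dpStepMTail P M xs]

/-- The length of the layer list is preserved by a masked step. [folklore] -/
private theorem length_dpStepM (P M : ℕ) : ∀ (T : List ℕ), (dpStepM P M T).length = T.length
  | [] => rfl
  | x :: xs => by
    show (x :: dpStepMTail P M xs x).length = _
    rw [List.length_cons, List.length_cons, length_dpStepMTail]

/-- The first new layer produced by `dpStepMTail`. [folklore] -/
private theorem dpStepMTail_getD_zero (P M : ℕ) : ∀ (xs : List ℕ) (prev : ℕ), xs ≠ [] →
    (dpStepMTail P M xs prev).getD 0 0 = xs.getD 0 0 + (prev * P &&& M)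
  | [], _, h => absurd rfl h
  | _ :: _, _, _ => rfl

/-- The recursion between consecutive new layers produced by `dpStepMTail`. [folklore] -/
private theorem dpStepMTail_getD_succ (P M : ℕ) : ∀ (xs : List ℕ) (prev j : ℕ), j + 1 < xs.length →
    (dpStepMTail P M xs prev).getD (j + 1) 0 =
      xs.getD (j + 1) 0 + ((dpStepMTail P M xs prev).getD j 0 * P &&& M)
  | [], _, _, h => absurd h (by simp)
  | x :: xs, prev, 0, h => by
    have hne : xs ≠ [] := by
      rintro rfl
      simp at h
    show (dpStepMTail P M xs _).getD 0 0 = _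
    rw [dpStepMTail_getD_zero P M xs _ hne]
    rfl
  | x :: xs, prev, j + 1, h => by
    show (dpStepMTail P M xs _).getD (j + 1) 0 =
      xs.getD (j + 1) 0 + ((dpStepMTail P M xs _).getD j 0 * P &&& M)
    exact dpStepMTail_getD_succ P M xs _ j (by rw [List.length_cons] at h; omega)

/-- Layer `0` is unchanged by a masked step. [folklore] -/
private theorem dpStepM_getD_zero (P M : ℕ) : ∀ (T : List ℕ), (dpStepM P M T).getD 0 0 = T.getD 0 0
  | [] => rfl
  | _ :: _ => rfl

/-- **The masked step recursion** `new_{e+1} = old_{e+1} + ((new_e · P) &&& M)`. [folklore] -/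
private theorem dpStepM_getD_succ (P M : ℕ) : ∀ (T : List ℕ) (e : ℕ), e + 1 < T.length →
    (dpStepM P M T).getD (e + 1) 0 = T.getD (e + 1) 0 + ((dpStepM P M T).getD e 0 * P &&& M)
  | [], _, h => absurd h (by simp)
  | x :: xs, 0, h => by
    have hne : xs ≠ [] := by
      rintro rfl
      simp at h
    show (dpStepMTail P M xs x).getD 0 0 = xs.getD 0 0 + (x * P &&& M)
    exact dpStepMTail_getD_zero P M xs x hne
  | x :: xs, e + 1, h => by
    show (dpStepMTail P M xs x).getD (e + 1) 0 =
      xs.getD (e + 1) 0 + ((dpStepMTail P M xs x).getD e 0 * P &&& M)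
    exact dpStepMTail_getD_succ P M xs x e (by rw [List.length_cons] at h; omega)

end DPM

/-! ### Correctness of the masked dynamic programme -/

section CorrectnessM

/-- The count stored at cell `(w₁,w₂,w₃)` of layer `e` (first coordinate forced by the total degree
`ne`). [cite: DorflerIkenmeyerPanova2020, eq. (4.3) (arXiv p. 9)] -/
def cvmT (L : List (Fin 4 → ℕ)) (n e w1 w2 w3 : ℕ) : ℕ :=
  countVecMultisets L e ![n * e - (w1 + w2 + w3), w1, w2, w3]

/-- A packed layer `X` represents layer `e` of the counts for `L` in the masked layout: at every
position, the digit is the count `cvmT` if the position decodes into the box, and `0` otherwise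
(padding and beyond). [cite: DorflerIkenmeyerPanova2020, eq. (4.3) (arXiv p. 9)] -/
def LayerOKM (F D1 D2 D3 R2 R3 n : ℕ) (L : List (Fin 4 → ℕ)) (e X : ℕ) : Prop :=
  ∀ p, digitAt F X p =
    if p / R3 / R2 < D1 ∧ p / R3 % R2 < D2 ∧ p % R3 < D3 then cvmT L n e (p / R3 / R2) (p / R3 % R2) (p % R3)
    else 0

/-- All `d+1` packed layers represent the counts for `L` (masked layout). [cite: DorflerIkenmeyerPanova2020, eq. (4.3) (arXiv p. 9)] -/
def TablesOKM (F D1 D2 D3 R2 R3 n d : ℕ) (L : List (Fin 4 → ℕ)) (T : List ℕ) : Prop :=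
  T.length = d + 1 ∧ ∀ e ≤ d, LayerOKM F D1 D2 D3 R2 R3 n L e (T.getD e 0)

/-- The sum of a `4`-vector (first coordinate first). [folklore] -/
private theorem sum_vec_four' (a b c d : ℕ) : ∑ i, (![a, b, c, d] : Fin 4 → ℕ) i = a + b + c + d := by
  rw [Fin.sum_univ_four]
  rfl

/-- **The digits of the box mask.** [folklore] -/
private theorem digitAt_boxMask {R2 R3 : ℕ} (hR2 : 0 < R2) (hR3 : 0 < R3) (F D1 D2 D3 p : ℕ) :
    digitAt F (boxMask F D1 D2 D3 R2 R3) p =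
      if p / R3 / R2 < D1 ∧ p / R3 % R2 < D2 ∧ p % R3 < D3 then 2 ^ F - 1 else 0 := by
  unfold boxMask
  have hones : 2 ^ F - 1 < 2 ^ F := Nat.sub_lt (Nat.two_pow_pos F) Nat.one_pos
  rw [digitAt_packDigits (fun q => by split_ifs; exacts [hones, Nat.two_pow_pos F])]
  by_cases hbox : p / R3 / R2 < D1 ∧ p / R3 % R2 < D2 ∧ p % R3 < D3
  · have hp : p < D1 * R2 * R3 := by
      rw [← boxIdx_decode R2 R3 p]
      exact (boxIdx_lt_iff (Nat.mod_lt _ hR2) (Nat.mod_lt _ hR3)).mpr hbox.1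
    rw [if_pos hp, if_pos hbox]
  · rw [if_neg hbox]
    split_ifs <;> rfl

/-- A layer in the masked layout, read at a box cell given by coordinates. [folklore] -/
private theorem LayerOKM.apply_cell {F D1 D2 D3 R2 R3 n : ℕ} {L : List (Fin 4 → ℕ)} {e X : ℕ}
    (hX : LayerOKM F D1 D2 D3 R2 R3 n L e X) {w1 w2 w3 : ℕ} (hw1 : w1 < D1) (hw2 : w2 < D2) (hw3 : w3 < D3)
    (hR2 : D2 ≤ R2) (hR3 : D3 ≤ R3) :
    digitAt F X (boxIdx R2 R3 w1 w2 w3) = cvmT L n e w1 w2 w3 := by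
  obtain ⟨e1, e2, e3⟩ := boxIdx_div_mod (R2 := R2) (R3 := R3) (w1 := w1) (w2 := w2) (w3 := w3)
    (by omega) (by omega)
  rw [hX, e1, e2, e3, if_pos ⟨hw1, hw2, hw3⟩]

/-- The initial layers represent the counts for the empty composition list (masked layout).
[cite: DorflerIkenmeyerPanova2020, eq. (4.3) (arXiv p. 9)] -/
theorem tablesOKM_dpInit {F D1 D2 D3 R2 R3 n : ℕ} (hF : 0 < F) (hD1 : 0 < D1) (hD2 : 0 < D2) (hD3 : 0 < D3)
    (hR2 : D2 ≤ R2) (hR3 : D3 ≤ R3) (d : ℕ) :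
    TablesOKM F D1 D2 D3 R2 R3 n d [] (dpInit d) := by
  refine ⟨by simp [dpInit], fun e he p => ?_⟩
  have hR2' : 0 < R2 := by omega
  have hR3' : 0 < R3 := by omega
  unfold cvmT
  rw [countVecMultisets]
  rcases e with _ | e
  · have hget : (dpInit d).getD 0 0 = 1 := by simp [dpInit]
    rw [hget, digitAt_one hF]
    have hdec := boxIdx_decode R2 R3 p
    have hzero : p = 0 ↔ p / R3 / R2 = 0 ∧ p / R3 % R2 = 0 ∧ p % R3 = 0 := by
      constructor
      · rintro rfl; simp
      · rintro ⟨h1, h2, h3⟩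
        rw [← hdec, h1, h2, h3]
        simp [boxIdx]
    have hvec : ∀ a b c : ℕ, ((![n * 0 - (a + b + c), a, b, c] : Fin 4 → ℕ) = 0 ↔ a = 0 ∧ b = 0 ∧ c = 0) := by
      intro a b c
      constructor
      · intro h
        have h1 := congrFun h 1
        have h2 := congrFun h 2
        have h3 := congrFun h 3
        simp at h1 h2 h3
        exact ⟨h1, h2, h3⟩
      · rintro ⟨rfl, rfl, rfl⟩
        funext i
        fin_cases i <;> simp
    by_cases hz : p / R3 / R2 = 0 ∧ p / R3 % R2 = 0 ∧ p % R3 = 0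
    · rw [if_pos (hzero.mpr hz), if_pos (by omega), if_pos ⟨rfl, (hvec _ _ _).mpr hz⟩]
    · rw [if_neg (mt hzero.mp hz)]
      split_ifs with h0 h3
      · exact absurd ((hvec _ _ _).mp h3.2) hz
      · rfl
      · rfl
  · have hget : (dpInit d).getD (e + 1) 0 = 0 := by
      unfold dpInit
      rw [List.getD_cons_succ, List.getD_eq_getElem?_getD, List.getElem?_replicate]
      split_ifs <;> rfl
    rw [hget, digitAt_zero]
    split_ifs with h0 h3
    · exact False.elim (by simpa using h3.1)
    · rfl
    · rfl

/-- **The shifted, masked digit is the second summand of the geometric step** (masked layout): for a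
box cell `w` and the new layer `e` (`X`, for `α :: L`), the digit of `X` at `boxIdx w − boxIdx α₁α₂α₃`
(zero if the shift does not fit) is `[α ≤ w] · countVecMultisets (α :: L) e (w − α)`; a shift never
wraps INTO the box because the padding `P ≥ n ≥ αᵢ` absorbs it.
[cite: DorflerIkenmeyerPanova2020, eq. (4.3) (arXiv p. 9)] -/
theorem digitAt_shiftM_eq {F D1 D2 D3 P n e : ℕ} (hP : n ≤ P) (α : Fin 4 → ℕ)
    (L : List (Fin 4 → ℕ)) (hα : ∑ i, α i = n) (hL : ∀ β ∈ L, ∑ i, β i = n) {X : ℕ}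
    (hX : LayerOKM F D1 D2 D3 (D2 + P) (D3 + P) n (α :: L) e X) {w1 w2 w3 : ℕ} (hw1 : w1 < D1)
    (hw2 : w2 < D2) (hw3 : w3 < D3) :
    (if boxIdx (D2 + P) (D3 + P) (α 1) (α 2) (α 3) ≤ boxIdx (D2 + P) (D3 + P) w1 w2 w3
      then digitAt F X (boxIdx (D2 + P) (D3 + P) w1 w2 w3 - boxIdx (D2 + P) (D3 + P) (α 1) (α 2) (α 3))
      else 0) =
    (if ∀ i, α i ≤ (![n * (e + 1) - (w1 + w2 + w3), w1, w2, w3] : Fin 4 → ℕ) i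
      then countVecMultisets (α :: L) e
        (fun i => (![n * (e + 1) - (w1 + w2 + w3), w1, w2, w3] : Fin 4 → ℕ) i - α i) else 0) := by
  have hα' : α 0 + α 1 + α 2 + α 3 = n := by rw [← hα, Fin.sum_univ_four]
  have hαL : ∀ β ∈ α :: L, ∑ i, β i = n := by
    intro β hβ
    rcases List.mem_cons.mp hβ with rfl | hβ
    · exact hα
    · exact hL β hβ
  rw [vec_four_sub]
  split_ifs with hs hc hc
  · -- the shift fits and `α ≤ w`: same cell
    obtain ⟨hc0, hc1, hc2, hc3⟩ := forall_fin_four.mp hc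
    change α 0 ≤ n * (e + 1) - (w1 + w2 + w3) at hc0
    change α 1 ≤ w1 at hc1; change α 2 ≤ w2 at hc2; change α 3 ≤ w3 at hc3
    have hp : boxIdx (D2 + P) (D3 + P) w1 w2 w3 - boxIdx (D2 + P) (D3 + P) (α 1) (α 2) (α 3) =
        boxIdx (D2 + P) (D3 + P) (w1 - α 1) (w2 - α 2) (w3 - α 3) := by
      apply Nat.sub_eq_of_eq_add
      rw [← boxIdx_add]
      congr 1 <;> omega
    rw [hp, hX.apply_cell (by omega) (by omega) (by omega) (Nat.le_add_right _ _) (Nat.le_add_right _ _)]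
    unfold cvmT
    change countVecMultisets (α :: L) e ![n * e - (w1 - α 1 + (w2 - α 2) + (w3 - α 3)), w1 - α 1, w2 - α 2, w3 - α 3] =
      countVecMultisets (α :: L) e ![n * (e + 1) - (w1 + w2 + w3) - α 0, w1 - α 1, w2 - α 2, w3 - α 3]
    have h4 : n * e - (w1 - α 1 + (w2 - α 2) + (w3 - α 3)) = n * (e + 1) - (w1 + w2 + w3) - α 0 := by
      rw [Nat.mul_succ] at hc0 ⊢
      omega
    rw [h4]
  · -- the shift fits but `α ≰ w`: the source position is outside the box or carries a zero count
    by_contra hne0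
    obtain ⟨q, hq⟩ : ∃ q, boxIdx (D2 + P) (D3 + P) w1 w2 w3 = q + boxIdx (D2 + P) (D3 + P) (α 1) (α 2) (α 3) :=
      ⟨_, (Nat.sub_add_cancel hs).symm⟩
    have hpq : boxIdx (D2 + P) (D3 + P) w1 w2 w3 - boxIdx (D2 + P) (D3 + P) (α 1) (α 2) (α 3) = q := by
      omega
    rw [hpq] at hne0
    have hdec := boxIdx_decode (D2 + P) (D3 + P) q
    have hx2lt : q / (D3 + P) % (D2 + P) < D2 + P := Nat.mod_lt _ (by omega)
    have hx3lt : q % (D3 + P) < D3 + P := Nat.mod_lt _ (by omega)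
    generalize hx1 : q / (D3 + P) / (D2 + P) = x1 at hdec
    generalize hx2 : q / (D3 + P) % (D2 + P) = x2 at hdec hx2lt
    generalize hx3 : q % (D3 + P) = x3 at hdec hx3lt
    subst hdec
    rw [hX] at hne0
    obtain ⟨e1, e2, e3⟩ := boxIdx_div_mod (R2 := D2 + P) (R3 := D3 + P) (w1 := x1) (w2 := x2) (w3 := x3)
      hx2lt hx3lt
    rw [e1, e2, e3] at hne0
    have hbox : x1 < D1 ∧ x2 < D2 ∧ x3 < D3 := by
      by_contra h
      exact hne0 (if_neg h)
    rw [if_pos hbox] at hne0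
    -- no wrap: the source cell plus `α` stays inside the padded axes
    have hs2 : x2 + α 2 < D2 + P := by omega
    have hs3 : x3 + α 3 < D3 + P := by omega
    have hpq' : boxIdx (D2 + P) (D3 + P) w1 w2 w3 = boxIdx (D2 + P) (D3 + P) (x1 + α 1) (x2 + α 2) (x3 + α 3) := by
      rw [boxIdx_add]; exact hq
    obtain ⟨f1, f2, f3⟩ := boxIdx_inj (by omega) (by omega) hs2 hs3 hpq'
    -- so `α ≤ w` on the three small coordinates; the first coordinate follows from the total degree
    unfold cvmT at hne0
    by_cases htot0 : x1 + x2 + x3 ≤ n * e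
    · apply hc
      refine forall_fin_four.mpr ⟨?_, ?_, ?_, ?_⟩
      · change α 0 ≤ n * (e + 1) - (w1 + w2 + w3)
        rw [Nat.mul_succ]
        omega
      · change α 1 ≤ w1; omega
      · change α 2 ≤ w2; omega
      · change α 3 ≤ w3; omega
    · have htot := sum_eq_of_countVecMultisets_ne_zero (α :: L) hαL e _ hne0
      rw [sum_vec_four'] at htot
      omega
  · -- the shift does not fit but `α ≤ w`: impossible
    exfalso
    obtain ⟨-, hc1, hc2, hc3⟩ := forall_fin_four.mp hc
    change α 1 ≤ w1 at hc1; change α 2 ≤ w2 at hc2; change α 3 ≤ w3 at hc3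
    apply hs
    have : boxIdx (D2 + P) (D3 + P) w1 w2 w3 =
        boxIdx (D2 + P) (D3 + P) (w1 - α 1) (w2 - α 2) (w3 - α 3) + boxIdx (D2 + P) (D3 + P) (α 1) (α 2) (α 3) := by
      rw [← boxIdx_add]
      congr 1 <;> omega
    omega
  · rfl

/-- **One masked step preserves the representation invariant.**
[cite: DorflerIkenmeyerPanova2020, eq. (4.3) (arXiv p. 9)] -/
theorem tablesOKM_dpStep {F D1 D2 D3 P n d : ℕ} (hD2 : 0 < D2) (hD3 : 0 < D3) (hP : n ≤ P)
    (α : Fin 4 → ℕ) (L : List (Fin 4 → ℕ)) (hα : ∑ i, α i = n) (hL : ∀ β ∈ L, ∑ i, β i = n)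
    (hbound : (L.length + 2) ^ d < 2 ^ F) {T : List ℕ}
    (hT : TablesOKM F D1 D2 D3 (D2 + P) (D3 + P) n d L T) :
    TablesOKM F D1 D2 D3 (D2 + P) (D3 + P) n d (α :: L)
      (dpStepM (2 ^ (F * boxIdx (D2 + P) (D3 + P) (α 1) (α 2) (α 3))) (boxMask F D1 D2 D3 (D2 + P) (D3 + P)) T) := by
  obtain ⟨hlen, hlay⟩ := hT
  have hα' : α 0 + α 1 + α 2 + α 3 = n := by rw [← hα, Fin.sum_univ_four]
  refine ⟨by rw [length_dpStepM, hlen], ?_⟩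
  intro e
  induction e with
  | zero =>
    intro _ p
    rw [dpStepM_getD_zero, hlay 0 (Nat.zero_le _) p]
    unfold cvmT
    rw [countVecMultisets_cons_zero]
  | succ e ih =>
    intro he
    have ihe := ih (Nat.le_of_succ_le he)
    rw [dpStepM_getD_succ _ _ T e (by rw [hlen]; omega)]
    set A := T.getD (e + 1) 0 with hA
    set C := (dpStepM (2 ^ (F * boxIdx (D2 + P) (D3 + P) (α 1) (α 2) (α 3)))
        (boxMask F D1 D2 D3 (D2 + P) (D3 + P)) T).getD e 0 *
      2 ^ (F * boxIdx (D2 + P) (D3 + P) (α 1) (α 2) (α 3)) &&& boxMask F D1 D2 D3 (D2 + P) (D3 + P) with hC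
    -- digits of the masked shifted layer
    have hCdig : ∀ p, digitAt F C p =
        if p / (D3 + P) / (D2 + P) < D1 ∧ p / (D3 + P) % (D2 + P) < D2 ∧ p % (D3 + P) < D3 then
          (if boxIdx (D2 + P) (D3 + P) (α 1) (α 2) (α 3) ≤ p then
            digitAt F ((dpStepM (2 ^ (F * boxIdx (D2 + P) (D3 + P) (α 1) (α 2) (α 3)))
              (boxMask F D1 D2 D3 (D2 + P) (D3 + P)) T).getD e 0)
              (p - boxIdx (D2 + P) (D3 + P) (α 1) (α 2) (α 3)) else 0)
        else 0 := by
      intro p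
      rw [hC, digitAt_land, digitAt_boxMask (by omega) (by omega), digitAt_mul_pow]
      split_ifs <;> first
        | exact land_ones_of_lt (digitAt_lt _ _ _)
        | exact land_ones_of_lt (Nat.two_pow_pos F)
        | exact Nat.and_zero _
    have key : ∀ p, digitAt F A p + digitAt F C p =
        if p / (D3 + P) / (D2 + P) < D1 ∧ p / (D3 + P) % (D2 + P) < D2 ∧ p % (D3 + P) < D3 then
          cvmT (α :: L) n (e + 1) (p / (D3 + P) / (D2 + P)) (p / (D3 + P) % (D2 + P)) (p % (D3 + P))
        else 0 := by
      intro p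
      rw [hA, hlay (e + 1) he p, hCdig p]
      by_cases hbox : p / (D3 + P) / (D2 + P) < D1 ∧ p / (D3 + P) % (D2 + P) < D2 ∧ p % (D3 + P) < D3
      · rw [if_pos hbox, if_pos hbox, if_pos hbox]
        unfold cvmT
        rw [countVecMultisets_cons_succ]
        congr 1
        have h := digitAt_shiftM_eq hP α L hα hL ihe hbox.1 hbox.2.1 hbox.2.2
        rw [boxIdx_decode] at h
        exact h
      · rw [if_neg hbox, if_neg hbox, if_neg hbox]
    have nocarry : ∀ j, digitAt F A j + digitAt F C j < 2 ^ F := by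
      intro j
      rw [key]
      split_ifs
      · unfold cvmT
        refine lt_of_le_of_lt ((countVecMultisets_le_pow _ _ _).trans ?_) hbound
        rw [List.length_cons]
        exact Nat.pow_le_pow_right (Nat.succ_pos _) he
      · exact Nat.two_pow_pos F
    intro p
    rw [digitAt_add A C nocarry, key p]

/-- **The masked dynamic programme represents the counts** for every list of compositions of `n`.
[cite: DorflerIkenmeyerPanova2020, eq. (4.3) (arXiv p. 9)] -/
theorem tablesOKM_dpRun {F D1 D2 D3 P n d : ℕ} (hF : 0 < F) (hD1 : 0 < D1) (hD2 : 0 < D2) (hD3 : 0 < D3)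
    (hP : n ≤ P) :
    ∀ (L : List (Fin 4 → ℕ)), (∀ β ∈ L, ∑ i, β i = n) → (L.length + 1) ^ d < 2 ^ F →
      TablesOKM F D1 D2 D3 (D2 + P) (D3 + P) n d L
        (dpRunM F (boxMask F D1 D2 D3 (D2 + P) (D3 + P)) (D2 + P) (D3 + P) L (dpInit d))
  | [], _, _ => tablesOKM_dpInit hF hD1 hD2 hD3 (Nat.le_add_right _ _) (Nat.le_add_right _ _) d
  | α :: L, hL, hb => by
    rw [dpRunM]
    refine tablesOKM_dpStep hD2 hD3 hP α L (hL α List.mem_cons_self)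
      (fun β hβ => hL β (List.mem_cons_of_mem _ hβ)) (by rw [List.length_cons] at hb; exact hb)
      (tablesOKM_dpRun hF hD1 hD2 hD3 hP L (fun β hβ => hL β (List.mem_cons_of_mem _ hβ))
        (lt_of_le_of_lt ?_ hb))
    rw [List.length_cons]
    exact Nat.pow_le_pow_left (Nat.le_succ _) d

/-- **Correctness of `dpTablesM`**: at a box cell, the digit of layer `e` is the four-letter monomial
count with the first coordinate forced. [cite: DorflerIkenmeyerPanova2020, eq. (4.3) (arXiv p. 9)] -/
theorem digitAt_dpTablesM {F D1 D2 D3 P n d : ℕ} (hF : ((weakComps 4 n).length + 1) ^ d < 2 ^ F)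
    (hP : n ≤ P) {e : ℕ} (he : e ≤ d) {w1 w2 w3 : ℕ} (hw1 : w1 < D1) (hw2 : w2 < D2) (hw3 : w3 < D3) :
    digitAt F ((dpTablesM F D1 D2 D3 P n d).getD e 0) (boxIdx (D2 + P) (D3 + P) w1 w2 w3) =
      countVecMultisets (weakComps 4 n) e ![n * e - (w1 + w2 + w3), w1, w2, w3] := by
  have hF0 : 0 < F := by
    refine Nat.pos_of_ne_zero fun h => ?_
    rw [h, pow_zero] at hF
    exact absurd hF (not_lt.mpr (Nat.one_le_pow _ _ (Nat.succ_pos _)))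
  have hD1 : 0 < D1 := by omega
  have hD2 : 0 < D2 := by omega
  have hD3 : 0 < D3 := by omega
  obtain ⟨-, hlay⟩ := tablesOKM_dpRun (d := d) hF0 hD1 hD2 hD3 hP (weakComps 4 n)
    (fun β hβ => mem_weakComps_iff.mp hβ) hF
  exact LayerOKM.apply_cell (hlay e he) hw1 hw2 hw3 (Nat.le_add_right _ _) (Nat.le_add_right _ _)

/-- **`c_ν(d,n)` for four letters, read off the masked table**: for `ν` of size `nd` with small
coordinates inside the box, `dipMonomialCount ν d n` is the digit of the last layer of `dpTablesM` at
`boxIdx (D₂+P) (D₃+P) ν₁ ν₂ ν₃`. [cite: DorflerIkenmeyerPanova2020, eq. (4.3) (arXiv p. 9)] -/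
theorem dipMonomialCount_eq_digitAt_dpTablesM {F D1 D2 D3 P n d : ℕ} (ν : Fin 4 → ℕ)
    (hν : ∑ i, ν i = n * d) (hν1 : ν 1 < D1) (hν2 : ν 2 < D2) (hν3 : ν 3 < D3) (hP : n ≤ P)
    (hF : ((weakComps 4 n).length + 1) ^ d < 2 ^ F) :
    dipMonomialCount ν d n =
      digitAt F ((dpTablesM F D1 D2 D3 P n d).getD d 0) (boxIdx (D2 + P) (D3 + P) (ν 1) (ν 2) (ν 3)) := by
  rw [dipMonomialCount_eq_eval, dipMonomialCountEval, digitAt_dpTablesM hF hP le_rfl hν1 hν2 hν3]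
  congr 1
  rw [Fin.sum_univ_four] at hν
  funext i
  fin_cases i
  · change ν 0 = n * d - (ν 1 + ν 2 + ν 3)
    omega
  · rfl
  · rfl
  · rfl

end CorrectnessM

/-! ### The right-hand side of (4.4) for four rows through the masked table -/

section FourRowsM

open _root_.Literature.NumberTheory.DiophantineGeometry

/-- Under the guard of (4.4), `λ + π − id` has the size of `λ`. [cite: DorflerIkenmeyerPanova2020, eq. (4.4) (arXiv p. 9)] -/
private theorem sum_shift_eq_four (lam : Fin 4 → ℕ) (π : Equiv.Perm (Fin 4))
    (hc : ∀ i : Fin 4, (i : ℕ) ≤ lam i + (π i : ℕ)) :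
    ∑ i : Fin 4, (lam i + (π i : ℕ) - (i : ℕ)) = ∑ i : Fin 4, lam i := by
  have hπsum : ∑ i : Fin 4, ((π i : Fin 4) : ℕ) = ∑ i : Fin 4, (i : ℕ) :=
    Equiv.sum_comp π (fun i : Fin 4 => (i : ℕ))
  have h1 : ∑ i : Fin 4, (lam i + (π i : ℕ) - (i : ℕ)) + ∑ i : Fin 4, (i : ℕ) =
      ∑ i : Fin 4, lam i + ∑ i : Fin 4, ((π i : Fin 4) : ℕ) := by
    rw [← Finset.sum_add_distrib, ← Finset.sum_add_distrib]
    exact Finset.sum_congr rfl fun i _ => Nat.sub_add_cancel (hc i)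
  rw [hπsum] at h1
  omega

/-- **The right-hand side of (4.4) for a `4`-row vector `λ` of size `dn`, with every monomial count read
off ONE masked table** (box `(λ₁+3, λ₂+2, λ₃+1)`, padding `n`): a pure counting identity (no antitonicity,
no `n ≥ 1`), kernel-evaluable on the right. This is the form in which the clamped tail sums of Lemma 3.13
(`dip44_sum_cons_clamp`) are evaluated. [cite: DorflerIkenmeyerPanova2020, eqs. (4.3)–(4.4) (arXiv p. 9)] -/
theorem dip44_rhs_eq_dpM (lam : Fin 4 → ℕ) {n d F : ℕ} (hsum : ∑ i, lam i = d * n)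
    (hF : ((weakComps 4 n).length + 1) ^ d < 2 ^ F) :
    (∑ π : Equiv.Perm (Fin 4), ((Equiv.Perm.sign π : ℤˣ) : ℤ) *
        (if ∀ i : Fin 4, (i : ℕ) ≤ lam i + (π i : ℕ)
          then (dipMonomialCount (fun i : Fin 4 => lam i + (π i : ℕ) - (i : ℕ)) d n : ℤ) else 0)) =
      ∑ π : Equiv.Perm (Fin 4), ((Equiv.Perm.sign π : ℤˣ) : ℤ) *
        (if ∀ i : Fin 4, (i : ℕ) ≤ lam i + (π i : ℕ)
          then (digitAt F ((dpTablesM F (lam 1 + 3) (lam 2 + 2) (lam 3 + 1) n n d).getD d 0)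
            (boxIdx (lam 2 + 2 + n) (lam 3 + 1 + n)
              (lam 1 + (π 1 : ℕ) - 1) (lam 2 + (π 2 : ℕ) - 2) (lam 3 + (π 3 : ℕ) - 3)) : ℤ)
          else 0) := by
  refine Finset.sum_congr rfl fun π _ => ?_
  split_ifs with hc
  · congr 1
    have hνsum : ∑ i : Fin 4, (lam i + (π i : ℕ) - (i : ℕ)) = n * d := by
      rw [sum_shift_eq_four lam π hc, hsum, Nat.mul_comm]
    have hπ1 : ((π 1 : Fin 4) : ℕ) < 4 := (π 1).isLt
    have hπ2 : ((π 2 : Fin 4) : ℕ) < 4 := (π 2).isLt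
    have hπ3 : ((π 3 : Fin 4) : ℕ) < 4 := (π 3).isLt
    exact_mod_cast dipMonomialCount_eq_digitAt_dpTablesM (fun i : Fin 4 => lam i + (π i : ℕ) - (i : ℕ))
      hνsum (by change lam 1 + _ - 1 < lam 1 + 3; omega) (by change lam 2 + _ - 2 < lam 2 + 2; omega)
      (by change lam 3 + _ - 3 < lam 3 + 1; omega) le_rfl hF
  · rfl

/-- **(4.4) for four rows through the masked table**: for a `4`-partition `λ` of `dn` (`n ≥ 1`),
`a_λ(d[n])` equals the kernel-evaluable masked right-hand side. [cite: DorflerIkenmeyerPanova2020, eqs. (4.3)–(4.4) (arXiv p. 9)] -/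
theorem plethysmCoeff_fin_four_cast_eq_dpM (lam : Fin 4 → ℕ) {n d F : ℕ} (hn : 0 < n)
    (h10 : lam 1 ≤ lam 0) (h21 : lam 2 ≤ lam 1) (h32 : lam 3 ≤ lam 2) (hsum : ∑ i, lam i = d * n)
    (hF : ((weakComps 4 n).length + 1) ^ d < 2 ^ F) :
    (plethysmCoeff ℂ (Fin 4) n (rowDual lam) : ℤ) =
      ∑ π : Equiv.Perm (Fin 4), ((Equiv.Perm.sign π : ℤˣ) : ℤ) *
        (if ∀ i : Fin 4, (i : ℕ) ≤ lam i + (π i : ℕ)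
          then (digitAt F ((dpTablesM F (lam 1 + 3) (lam 2 + 2) (lam 3 + 1) n n d).getD d 0)
            (boxIdx (lam 2 + 2 + n) (lam 3 + 1 + n)
              (lam 1 + (π 1 : ℕ) - 1) (lam 2 + (π 2 : ℕ) - 2) (lam 3 + (π 3 : ℕ) - 3)) : ℤ)
          else 0) := by
  rw [DIP20_eq_4_4_holds 4 n d lam hn (antitone_fin_four h10 h21 h32) hsum]
  exact dip44_rhs_eq_dpM lam hsum hF

end FourRowsM

end Literature.Computability.AlgebraicComplexity
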